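import Summits.QuantumFields.YangMills.Theorems.ParabolicTrajectoryLatticeGapOnTrajectoryTransferFromOSGap
import Literature.MathematicalPhysics.QuantumLattice.ReflectedCorrelationPolarisation
import Literature.MathematicalPhysics.QuantumFieldTheory.ConstructiveQFTWave0SiteRPProofs
import Literature.MathematicalPhysics.QuantumFieldTheory.LatticeGaugeProofs

/-!
# Crux `ContinuumLimitOnTrajectory` (stmt-QuantumFields-10522), line `two-orbit-synchronisation` (seat c2):
# the polarised slab gap — off-diagonal clustering of slab observables from a torus OS gap

Helper file (`--supports stmt-QuantumFields-10522`) for the registered stub `stub_uclOfGap : UCLOfGap` (skeleton v3.1).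
From crux (B)'s OS-currency gap on the scheme's own torus, `TorusOSGap r sch Δ` (a DIAGONAL bound
`‖osCorr τ_m (X, X)‖ ≤ osVar X · e^{−Δ a_k m}` for bounded measurable `X` localised in the time slab `1 … w`, `m + 2w ≤ L_k`),
this file derives:

* `slabGood_add_smul` — the class of bounded measurable slab-localised observables is closed under `X + c • Y`;
* `osVar_nonneg_of_torusOSGap` — the `m = 0` case of the gap is reflection positivity of slab observables: `0 ≤ osVar X`;
* `norm_osCorr_slab_le_of_torusOSGap` — POLARISED form: for two slab observables `Y, Z`,
  `‖osCorr Θ' τ_m (Y, Z)‖ ≤ 2 (osVar Y + osVar Z) e^{−Δ a_k m}` (tree `norm_osCorr_le_of_gap`).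

This is the engine of the clustering leg: `Y` will be the lattice observable of the windowed left factor (reflected into
positive times), `Z` that of the windowed, back-translated right factor, and the OS variances are values of the canonical
distributions controlled by the uniform UV bounds. Vocabulary-free (tree imports only); nothing about Wilson's theory is
asserted. References: Osterwalder–Seiler 1978 §2; Glimm–Jaffe 1987 §6.1.
-/

set_option autoImplicit false

open scoped ComplexConjugate
open MeasureTheory Filter
open Literature.MathematicalPhysics.QuantumLattice Literature.MathematicalPhysics.QuantumFieldTheory
open Summit.QuantumFields.YangMills.Cruxes.LatticeGapOnTrajectory.OrbitKantorovichFiniteSize.Transfer (TorusOSGap)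

noncomputable section

namespace Summit.QuantumFields.YangMills.Cruxes.ContinuumLimitOnTrajectory.TwoOrbitSynchronisation

variable {G : Type} [Group G] [TopologicalSpace G] [IsTopologicalGroup G] [CompactSpace G]
  [MeasurableSpace G] [BorelSpace G]

/-- The time slab of links based at lattice times `1, …, w` of the torus of side `Sd` (the localisation class of `TorusOSGap`). -/
def slabEdges (Sd w : ℕ) : Set (Edge 4 Sd) := {e | 1 ≤ (e.1 0).val ∧ (e.1 0).val ≤ w}

/-- **Slab observables**: bounded measurable complex observables of the torus of side `Sd` depending only on the links of
the time slab `1 … w`. -/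
def SlabGood (Sd w : ℕ) (X : GaugeConfig 4 Sd G → ℂ) : Prop :=
  Measurable X ∧ (∃ B : ℝ, ∀ U, ‖X U‖ ≤ B) ∧ DependsOn X (slabEdges Sd w)

omit [Group G] [TopologicalSpace G] [IsTopologicalGroup G] [CompactSpace G] [BorelSpace G] in
/-- Slab observables are closed under `X + c • Y`. -/
theorem slabGood_add_smul {Sd w : ℕ} {X Y : GaugeConfig 4 Sd G → ℂ} (c : ℂ) (hX : SlabGood Sd w X)
    (hY : SlabGood Sd w Y) : SlabGood Sd w (X + c • Y) := by
  obtain ⟨hXm, ⟨B₁, hB₁⟩, hXd⟩ := hX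
  obtain ⟨hYm, ⟨B₂, hB₂⟩, hYd⟩ := hY
  refine ⟨hXm.add (hYm.const_smul c), ⟨B₁ + ‖c‖ * B₂, fun U => ?_⟩, fun U V h => ?_⟩
  · calc ‖(X + c • Y) U‖ = ‖X U + c * Y U‖ := rfl
      _ ≤ ‖X U‖ + ‖c * Y U‖ := norm_add_le _ _
      _ ≤ B₁ + ‖c‖ * B₂ := by
          rw [norm_mul]; exact add_le_add (hB₁ U) (mul_le_mul_of_nonneg_left (hB₂ U) (norm_nonneg _))
  · simp only [Pi.add_apply, Pi.smul_apply, smul_eq_mul]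
    rw [hXd h, hYd h]

/-- A complex number dominated in norm by its own real part has non-negative real part. -/
theorem re_nonneg_of_norm_le_re {z : ℂ} (h : ‖z‖ ≤ z.re) : 0 ≤ z.re := (norm_nonneg z).trans h

/-- **`TorusOSGap` at `m = 0` is reflection positivity of slab observables**: `0 ≤ osVar X`. -/
theorem osVar_nonneg_of_torusOSGap (r : LatticeRep G) (sch : SpeciesScheme (YMSpecies G)) {Δ : ℝ} {k₀ : ℕ}
    (hk₀ : ∀ k ≥ k₀, ∀ (w m : ℕ) (X : GaugeConfig 4 (sch.side k) G → ℂ), Measurable X →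
      (∃ B, ∀ U, ‖X U‖ ≤ B) →
      DependsOn X {e : Edge 4 (sch.side k) | 1 ≤ (e.1 0).val ∧ (e.1 0).val ≤ w} →
      m + 2 * w ≤ sch.L k →
        ‖(∫ U, conj (X U.negReflect) * X (torusTimeShift (sch.side k) m U) ∂(wilsonMeasure r.ρ (sch.β k))) -
            conj (∫ U, X U ∂(wilsonMeasure r.ρ (sch.β k))) * ∫ U, X U ∂(wilsonMeasure r.ρ (sch.β k))‖ ≤
          ((∫ U, conj (X U.negReflect) * X U ∂(wilsonMeasure r.ρ (sch.β k))) -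
              conj (∫ U, X U ∂(wilsonMeasure r.ρ (sch.β k))) * ∫ U, X U ∂(wilsonMeasure r.ρ (sch.β k))).re *
            Real.exp (-Δ * sch.a k * m))
    {k : ℕ} (hk : k₀ ≤ k) {w : ℕ} (hw : 2 * w ≤ sch.L k) {X : GaugeConfig 4 (sch.side k) G → ℂ}
    (hX : SlabGood (sch.side k) w X) :
    0 ≤ osVar (wilsonMeasure r.ρ (sch.β k)) GaugeConfig.negReflect X := by
  have h0 := hk₀ k hk w 0 X hX.1 hX.2.1 hX.2.2 (by omega)
  simp only [Summit.QuantumFields.YangMills.Cruxes.LatticeGapOnTrajectory.OrbitKantorovichFiniteSize.Transfer.coe_torusTimeShift_zero,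
    id, Nat.cast_zero, mul_zero, Real.exp_zero, mul_one] at h0
  exact re_nonneg_of_norm_le_re h0

/-- **Polarised slab gap.** Under `TorusOSGap r sch Δ`: eventually in `k`, for all slab observables `Y, Z` of the slab `1 … w` and
every time shift `m` with `m + 2w ≤ L_k`,
`‖osCorr Θ' τ_m (Y, Z)‖ ≤ 2 (osVar Y + osVar Z) e^{−Δ a_k m}`
(`Θ' = negReflect`, `τ_m = torusTimeShift _ m`, Wilson's measure at `β_k`). -/
theorem norm_osCorr_slab_le_of_torusOSGap :
    ∀ {G : Type} [Group G] [TopologicalSpace G] [IsTopologicalGroup G] [CompactSpace G] [MeasurableSpace G] [BorelSpace G]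
      (r : LatticeRep G) (sch : SpeciesScheme (YMSpecies G)) {Δ : ℝ}, TorusOSGap r sch Δ →
    ∃ k₀ : ℕ, ∀ k ≥ k₀, ∀ (w m : ℕ) (Y Z : GaugeConfig 4 (sch.side k) G → ℂ),
      SlabGood (sch.side k) w Y → SlabGood (sch.side k) w Z → m + 2 * w ≤ sch.L k →
        ‖osCorr (wilsonMeasure r.ρ (sch.β k)) GaugeConfig.negReflect (torusTimeShift (sch.side k) m) Y Z‖ ≤
          2 * (osVar (wilsonMeasure r.ρ (sch.β k)) GaugeConfig.negReflect Y +
              osVar (wilsonMeasure r.ρ (sch.β k)) GaugeConfig.negReflect Z) * Real.exp (-Δ * sch.a k * m) := by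
  intro G _ _ _ _ _ _ r sch Δ hgap
  obtain ⟨k₀, hk₀⟩ := hgap
  refine ⟨k₀, fun k hk w m Y Z hY hZ hmw => ?_⟩
  haveI : IsProbabilityMeasure (wilsonMeasure (d := 4) (L := sch.side k) (G := G) r.ρ (sch.β k)) :=
    isProbabilityMeasure_wilsonMeasure r.ρ r.continuous _
  have hw : 2 * w ≤ sch.L k := by omega
  refine norm_osCorr_le_of_gap (μ := wilsonMeasure r.ρ (sch.β k)) (Good := SlabGood (sch.side k) w)
    WilsonSiteRP.measurable_negReflect (torusTimeShift (sch.side k) m).measurable (fun X hX => hX.1) (fun X hX => hX.2.1)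
    (fun X X' c hX hX' => slabGood_add_smul c hX hX') (Real.exp_nonneg _) (fun X hX => ?_)
    (fun X hX => osVar_nonneg_of_torusOSGap r sch hk₀ hk hw hX) hY hZ
  have h := hk₀ k hk w m X hX.1 hX.2.1 hX.2.2 hmw
  simpa only [osCorr, osVar, id] using h

end Summit.QuantumFields.YangMills.Cruxes.ContinuumLimitOnTrajectory.TwoOrbitSynchronisation

end
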